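import Literature.NumberTheory.EllipticCurves.PAdicMeasureWeightKActionLaw
import HarnessLib

/-!
# The lattice `𝔻⁰` of `ℤ_p`-valued measures, its congruence submodules, and their stability under
# the weight-`k` action

For the module `𝔻 = 𝔻(T, ℚ_p)` of bounded `ℚ_p`-valued distributions on a profinite tower `T`
(`PAdicDistributionModule`) we introduce the `ℤ_p`-lattice and its congruence filtration

  `𝔻⁰ = {μ : ‖μ_n(a)‖ ≤ 1}`,   `K_N = {μ ∈ 𝔻⁰ : ‖μ_N(a)‖ ≤ p^{-N} for all a}`

(`distributionsInt`, `congrSub`).  By the distribution relation `K_N` also controls the lower levels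
(`norm_le_of_mem_congrSub`), `⋂_N K_N = 0` (`eq_zero_of_forall_mem_congrSub`), and `K_N` is the kernel
of the reduction `μ ↦ (μ_N(a) mod p^N)_a` to the FINITE group `(T.Cell N → ℤ/p^N)` (`reduce`,
`mem_congrSub_iff_reduce_eq_zero`) — so `𝔻⁰/K_N` is finite and `𝔻⁰ = lim 𝔻⁰/K_N` is profinite, which
is what makes Hida's ordinary projector `e = lim U_p^{n!}` available on `𝔻⁰`-valued modular symbols
without Banach-space theory (the tree's `Automorphic/OrdinaryPartOfFiniteModule`).

The key analytic estimate (`norm_integralFn_le_of_mem_congrSub`): for `μ ∈ K_N` and `g` with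
`‖g‖ ≤ 1` varying by at most `p^{-N}` on level-`N` cells, `‖∫ g dμ‖ ≤ p^{-N}`.  On `ℤ_p` the integrands
`1_s(m_γ z)(a + cz)^k` of the weight-`k` action of `γ ∈ Σ₀(p)` are of this kind
(`norm_autPow_sub_autPow_le`), whence **`𝔻⁰` and every `K_N` are stable under the weight-`k`
action** (`weightActD_mem_distributionsInt`, `weightActD_mem_congrSub`; Pollack–Stevens 2011, §3,
finite approximation modules; Greenberg–Stevens 1993, §1).

Brick B2g of the bottom-up plan recorded with the named fact
`greenbergStevens_kitagawa_twoVariable_interpolation_allBranches`.  Everything is proved; no named facts.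

## References

* R. Pollack, G. Stevens, Ann. Sci. ÉNS 44 (2011), §3. [PollackStevens2011]
* J. Bellaïche, *The Eigenbook* (2021), §6.5. [folklore]
* R. Greenberg, G. Stevens, Invent. Math. 111 (1993), §1. [GreenbergStevens1993]
-/

noncomputable section

open Filter Topology

namespace Literature.NumberTheory.EllipticCurves

variable {p : ℕ} [Fact p.Prime]

/-! ### The lattice `𝔻⁰` and the congruence submodules `K_N` -/

namespace ProfiniteTower

variable {X : Type*} [PseudoMetricSpace X] (T : ProfiniteTower X)

variable (p) in
/-- **The lattice `𝔻⁰(T) ⊆ 𝔻(T, ℚ_p)` of `ℤ_p`-valued bounded distributions** (all level data of norm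
`≤ 1`), a `ℤ_p`-submodule. [cite: GreenbergStevens1993, §1] -/
def distributionsInt : Submodule ℤ_[p] ((n : ℕ) → T.Cell n → ℚ_[p]) where
  carrier := {μ | μ ∈ T.distributions ℚ_[p] ∧ ∀ (n : ℕ) (a : T.Cell n), ‖μ n a‖ ≤ 1}
  add_mem' := by
    rintro μ ν ⟨hμ, hμ1⟩ ⟨hν, hν1⟩
    refine ⟨add_mem hμ hν, fun n a => ?_⟩
    rw [Pi.add_apply, Pi.add_apply]
    exact (IsUltrametricDist.norm_add_le_max _ _).trans (max_le (hμ1 n a) (hν1 n a))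
  zero_mem' := ⟨zero_mem _, fun n a => by simp⟩
  smul_mem' := by
    rintro c μ ⟨hμ, hμ1⟩
    refine ⟨?_, fun n a => ?_⟩
    · rw [show c • μ = (c : ℚ_[p]) • μ from rfl]
      exact Submodule.smul_mem _ _ hμ
    · rw [Pi.smul_apply, Pi.smul_apply, show c • μ n a = (c : ℚ_[p]) * μ n a from rfl, norm_mul,
        PadicInt.padic_norm_e_of_padicInt]
      exact mul_le_one₀ (PadicInt.norm_le_one c) (norm_nonneg _) (hμ1 n a)

/-- Membership in `𝔻⁰`. [folklore] -/
theorem mem_distributionsInt_iff {μ : (n : ℕ) → T.Cell n → ℚ_[p]} :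
    μ ∈ T.distributionsInt p ↔ μ ∈ T.distributions ℚ_[p] ∧ ∀ (n : ℕ) (a : T.Cell n), ‖μ n a‖ ≤ 1 := Iff.rfl

/-- The bounded distribution with bound `1` attached to `μ ∈ 𝔻⁰`. [folklore] -/
def toBounded₁ {μ : (n : ℕ) → T.Cell n → ℚ_[p]} (hμ : μ ∈ T.distributionsInt p) : BoundedDistribution T ℚ_[p] where
  μ := μ
  sum_fiber := hμ.1.1
  bound := 1
  bound_nonneg := zero_le_one
  norm_le := hμ.2

/-- The level data of `toBounded₁`. [folklore] -/
@[simp] theorem toBounded₁_μ {μ : (n : ℕ) → T.Cell n → ℚ_[p]} (hμ : μ ∈ T.distributionsInt p) :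
    (T.toBounded₁ hμ).μ = μ := rfl

/-- The bound of `toBounded₁` is `1`. [folklore] -/
@[simp] theorem toBounded₁_bound {μ : (n : ℕ) → T.Cell n → ℚ_[p]} (hμ : μ ∈ T.distributionsInt p) :
    (T.toBounded₁ hμ).bound = 1 := rfl

variable (p) in
/-- **The congruence submodule `K_N = {μ ∈ 𝔻⁰ : ‖μ_N(a)‖ ≤ p^{-N}}`** (level-`N` data divisible by
`p^N`); `𝔻⁰/K_N` is the level-`N` finite approximation module. [cite: PollackStevens2011, §3] -/
def congrSub (N : ℕ) : Submodule ℤ_[p] ((n : ℕ) → T.Cell n → ℚ_[p]) where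
  carrier := {μ | μ ∈ T.distributionsInt p ∧ ∀ a : T.Cell N, ‖μ N a‖ ≤ (p : ℝ) ^ (-(N : ℤ))}
  add_mem' := by
    rintro μ ν ⟨hμ, hμN⟩ ⟨hν, hνN⟩
    refine ⟨add_mem hμ hν, fun a => ?_⟩
    rw [Pi.add_apply, Pi.add_apply]
    exact (IsUltrametricDist.norm_add_le_max _ _).trans (max_le (hμN a) (hνN a))
  zero_mem' := ⟨zero_mem _, fun a => by simp⟩
  smul_mem' := by
    rintro c μ ⟨hμ, hμN⟩
    refine ⟨Submodule.smul_mem _ c hμ, fun a => ?_⟩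
    rw [Pi.smul_apply, Pi.smul_apply, show c • μ N a = (c : ℚ_[p]) * μ N a from rfl, norm_mul,
      PadicInt.padic_norm_e_of_padicInt]
    calc ‖c‖ * ‖μ N a‖ ≤ 1 * (p : ℝ) ^ (-(N : ℤ)) :=
        mul_le_mul (PadicInt.norm_le_one c) (hμN a) (norm_nonneg _) zero_le_one
      _ = (p : ℝ) ^ (-(N : ℤ)) := one_mul _

/-- Membership in `K_N`. [folklore] -/
theorem mem_congrSub_iff {N : ℕ} {μ : (n : ℕ) → T.Cell n → ℚ_[p]} :
    μ ∈ T.congrSub p N ↔ μ ∈ T.distributionsInt p ∧ ∀ a : T.Cell N, ‖μ N a‖ ≤ (p : ℝ) ^ (-(N : ℤ)) := Iff.rfl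

/-- `K_N ⊆ 𝔻⁰`. [folklore] -/
theorem congrSub_le (N : ℕ) : T.congrSub p N ≤ T.distributionsInt p := fun _ h => h.1

/-- **`K_N` controls the lower levels**: for `μ ∈ K_N` and `n ≤ N`, `‖μ_n(a)‖ ≤ p^{-N}` (iterate the
distribution relation; ultrametric). [folklore] -/
theorem norm_le_of_mem_congrSub {N : ℕ} {μ : (n : ℕ) → T.Cell n → ℚ_[p]} (hμ : μ ∈ T.congrSub p N)
    {n : ℕ} (hn : n ≤ N) (a : T.Cell n) : ‖μ n a‖ ≤ (p : ℝ) ^ (-(N : ℤ)) := by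
  obtain ⟨k, rfl⟩ := Nat.exists_eq_add_of_le hn
  have h := (T.toBounded₁ hμ.1).sum_mul_eq_sum_add n (fun b => if b = a then (1 : ℚ_[p]) else 0) k
  simp only [toBounded₁_μ, mul_ite, mul_one, mul_zero, Finset.sum_ite_eq', Finset.mem_univ, if_true] at h
  rw [h]
  refine IsUltrametricDist.norm_sum_le_of_forall_le_of_nonneg (by positivity) fun b _ => ?_
  split_ifs
  · exact hμ.2 b
  · rw [norm_zero]; positivity

/-- **`⋂_N K_N = 0`.** [folklore] -/
theorem eq_zero_of_forall_mem_congrSub {μ : (n : ℕ) → T.Cell n → ℚ_[p]} (hμ : ∀ N, μ ∈ T.congrSub p N) :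
    μ = 0 := by
  funext n a
  have hp1 : (1 : ℝ) < p := by exact_mod_cast (Fact.out : p.Prime).one_lt
  have h0 : ∀ ε : ℝ, 0 < ε → ‖μ n a‖ < ε := fun ε hε => by
    obtain ⟨N, hN⟩ := exists_pow_lt_of_lt_one hε (inv_lt_one_of_one_lt₀ hp1)
    calc ‖μ n a‖ ≤ (p : ℝ) ^ (-((n + N : ℕ) : ℤ)) :=
          T.norm_le_of_mem_congrSub (hμ (n + N)) (Nat.le_add_right n N) a
      _ ≤ (p : ℝ) ^ (-(N : ℤ)) := zpow_le_zpow_right₀ hp1.le (by omega)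
      _ = ((p : ℝ)⁻¹) ^ N := by rw [zpow_neg, zpow_natCast, inv_pow]
      _ < ε := hN
  exact norm_eq_zero.mp (le_antisymm (le_of_forall_pos_lt_add fun ε hε => by
    linarith [h0 ε hε]) (norm_nonneg _))

/-- **Reduction modulo `p^N` of the level-`N` data**: `𝔻⁰ → (T.Cell N → ℤ/p^N)`, an additive map to a
finite group. [folklore] -/
def reduce (N : ℕ) : T.distributionsInt p →+ (T.Cell N → ZMod (p ^ N)) where
  toFun μ a := PadicInt.toZModPow N ⟨μ.1 N a, μ.2.2 N a⟩
  map_zero' := by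
    funext a
    simp only [Pi.zero_apply]
    rw [← map_zero (PadicInt.toZModPow N)]
    congr 1
  map_add' μ ν := by
    funext a
    simp only [Pi.add_apply]
    rw [← map_add]
    congr 1

/-- **`K_N` is the kernel of the reduction**: `μ ∈ K_N ↔ reduce N μ = 0` for `μ ∈ 𝔻⁰`. [folklore] -/
theorem mem_congrSub_iff_reduce_eq_zero (N : ℕ) (μ : T.distributionsInt p) :
    (μ : (n : ℕ) → T.Cell n → ℚ_[p]) ∈ T.congrSub p N ↔ T.reduce N μ = 0 := by
  constructor
  · intro h
    funext a
    change PadicInt.toZModPow N ⟨μ.1 N a, μ.2.2 N a⟩ = 0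
    rw [← RingHom.mem_ker, PadicInt.ker_toZModPow, ← PadicInt.norm_le_pow_iff_mem_span_pow]
    exact h.2 a
  · intro h
    refine ⟨μ.2, fun a => ?_⟩
    have ha := congr_fun h a
    change PadicInt.toZModPow N ⟨μ.1 N a, μ.2.2 N a⟩ = 0 at ha
    rw [← RingHom.mem_ker, PadicInt.ker_toZModPow, ← PadicInt.norm_le_pow_iff_mem_span_pow] at ha
    exact ha

/-- The target of the reduction is finite. [folklore] -/
instance finite_cell_fun (N : ℕ) : Finite (T.Cell N → ZMod (p ^ N)) := by
  haveI : NeZero (p ^ N) := ⟨pow_ne_zero _ (Fact.out : p.Prime).ne_zero⟩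
  infer_instance

end ProfiniteTower

/-! ### The key estimate on `ℤ_p`: integrals of almost-step functions against `μ ∈ K_N` -/

section Estimate

/-- **Integrals against `μ ∈ K_N` are divisible by `p^N`** for integrands `g : ℤ_p → ℚ_p` with
`‖g‖ ≤ 1` which vary by at most `p^{-N}` on the residue classes modulo `p^N`: `‖∫ g dμ‖ ≤ p^{-N}`
(split `g` into the step function `g_N(x) = g(x mod p^N)`, integrated exactly by
`integral_eq_sum_of_factorsThrough`, and `g − g_N` of sup-norm `≤ p^{-N}`). [folklore] -/
theorem norm_integralFn_le_of_mem_congrSub {N : ℕ} {μ : (n : ℕ) → ZMod (p ^ n) → ℚ_[p]}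
    (hμ : μ ∈ (ProfiniteTower.padicInt p).congrSub p N) {g : ℤ_[p] → ℚ_[p]} (hg : UniformContinuous g)
    (hg1 : ∀ x, ‖g x‖ ≤ 1)
    (hgN : ∀ x y : ℤ_[p], PadicInt.toZModPow N x = PadicInt.toZModPow N y → ‖g x - g y‖ ≤ (p : ℝ) ^ (-(N : ℤ))) :
    ‖(ProfiniteTower.padicInt p).integralFn μ g‖ ≤ (p : ℝ) ^ (-(N : ℤ)) := by
  haveI : NeZero (p ^ N) := ⟨pow_ne_zero _ (Fact.out : p.Prime).ne_zero⟩
  set D := (ProfiniteTower.padicInt p).toBounded₁ hμ.1 with hD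
  have hpN : (0 : ℝ) ≤ (p : ℝ) ^ (-(N : ℤ)) := by positivity
  -- the step function `g_N`
  set gN : ℤ_[p] → ℚ_[p] := fun x => g ((PadicInt.toZModPow N x).val : ℤ_[p]) with hgNdef
  have hgN_uc : UniformContinuous gN := uniformContinuous_comp_toZModPow N fun a => g (a.val : ℤ_[p])
  have hstep : D.integral gN = ∑ a : ZMod (p ^ N), μ N a * g (a.val : ℤ_[p]) :=
    D.integral_eq_sum_of_factorsThrough (m := N) (fun a : ZMod (p ^ N) => g (a.val : ℤ_[p])) fun x => rfl
  have h1 : ‖D.integral gN‖ ≤ (p : ℝ) ^ (-(N : ℤ)) := by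
    rw [hstep]
    refine IsUltrametricDist.norm_sum_le_of_forall_le_of_nonneg hpN fun a _ => ?_
    rw [norm_mul]
    calc ‖μ N a‖ * ‖g (a.val : ℤ_[p])‖ ≤ (p : ℝ) ^ (-(N : ℤ)) * 1 :=
        mul_le_mul (hμ.2 a) (hg1 _) (norm_nonneg _) hpN
      _ = (p : ℝ) ^ (-(N : ℤ)) := mul_one _
  have h2 : ‖D.integral fun x => g x - gN x‖ ≤ 1 * (p : ℝ) ^ (-(N : ℤ)) := by
    refine D.norm_integral_le (hg.sub hgN_uc) hpN fun x => hgN x _ ?_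
    rw [map_natCast, ZMod.natCast_zmod_val]
  have hsplit : (ProfiniteTower.padicInt p).integralFn μ g = D.integral gN + D.integral fun x => g x - gN x := by
    rw [← D.integral_add hgN_uc (hg.sub hgN_uc)]
    change D.integral g = _
    exact congr_arg D.integral (funext fun x => by ring)
  rw [hsplit]
  refine (IsUltrametricDist.norm_add_le_max _ _).trans (max_le h1 ?_)
  rwa [one_mul] at h2

end Estimate

/-! ### Stability of `𝔻⁰(ℤ_p)` and of the `K_N` under the weight-`k` action -/

section WeightK

/-- `‖(a + cx)^k − (a + cy)^k‖ ≤ ‖x − y‖` in `ℤ_p` (the difference of `k`-th powers is divisible by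
`c (x − y)`). [folklore] -/
theorem norm_autFactor_pow_sub_pow_le (k : ℕ) (a c x y : ℤ_[p]) :
    ‖(a + c * x) ^ k - (a + c * y) ^ k‖ ≤ ‖x - y‖ := by
  have h := (Commute.all (a + c * x) (a + c * y)).geom_sum₂_mul k
  rw [← h, norm_mul, show a + c * x - (a + c * y) = c * (x - y) by ring, norm_mul]
  calc ‖∑ i ∈ Finset.range k, (a + c * x) ^ i * (a + c * y) ^ (k - 1 - i)‖ * (‖c‖ * ‖x - y‖)
      ≤ 1 * (1 * ‖x - y‖) := by
        refine mul_le_mul (PadicInt.norm_le_one _) (mul_le_mul (PadicInt.norm_le_one _) le_rfl (norm_nonneg _)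
          zero_le_one) (by positivity) zero_le_one
    _ = ‖x - y‖ := by ring

/-- The automorphy powers (`𝕜 = ℚ_p`) vary by at most `‖x − y‖`. [folklore] -/
theorem norm_autPow_sub_autPow_le (k : ℕ) (a c x y : ℤ_[p]) :
    ‖BoundedDistribution.autPow (𝕜 := ℚ_[p]) k a c x - BoundedDistribution.autPow (𝕜 := ℚ_[p]) k a c y‖ ≤ ‖x - y‖ := by
  rw [BoundedDistribution.autPow_apply, BoundedDistribution.autPow_apply, Algebra.algebraMap_self, RingHom.id_apply,
    RingHom.id_apply, ← PadicInt.coe_sub, PadicInt.padic_norm_e_of_padicInt]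
  exact norm_autFactor_pow_sub_pow_le k a c x y

/-- The integrand of the level data of the weight-`k` action has norm `≤ 1`. [folklore] -/
theorem norm_cellInd_moebius_mul_autPow_le (k : ℕ) {a c : ℤ_[p]} (ha : ‖a‖ = 1) (hc : ‖c‖ < 1) (b d : ℤ_[p])
    (n : ℕ) (s : ZMod (p ^ n)) (z : ℤ_[p]) :
    ‖cellInd (𝕜 := ℚ_[p]) n s (moebius ha hc b d z) * BoundedDistribution.autPow (𝕜 := ℚ_[p]) k a c z‖ ≤ 1 := by
  rw [norm_mul]
  exact mul_le_one₀ (norm_cellInd_le _ _ _) (norm_nonneg _) (BoundedDistribution.norm_autPow_le k a c z)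

/-- **`𝔻⁰(ℤ_p)` is stable under the weight-`k` action of `Σ₀(p)`.** [cite: PollackStevens2011, §3] -/
theorem weightActD_mem_distributionsInt (k : ℕ) {a c : ℤ_[p]} (ha : ‖a‖ = 1) (hc : ‖c‖ < 1) (b d : ℤ_[p])
    (μ : (ProfiniteTower.padicInt p).distributions ℚ_[p])
    (hμ : μ.1 ∈ (ProfiniteTower.padicInt p).distributionsInt p) :
    (weightActD p ℚ_[p] k ha hc b d μ).1 ∈ (ProfiniteTower.padicInt p).distributionsInt p := by
  refine ⟨(weightActD p ℚ_[p] k ha hc b d μ).2, fun n s => ?_⟩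
  have h := weightActD_apply (𝕜 := ℚ_[p]) k ha hc b d μ n s
  rw [show (ProfiniteTower.padicInt p).integralFn μ.1
      (fun z => cellInd n s (moebius ha hc b d z) * BoundedDistribution.autPow k a c z) =
      ((ProfiniteTower.padicInt p).toBounded₁ hμ).integral
        (fun z => cellInd n s (moebius ha hc b d z) * BoundedDistribution.autPow k a c z) from rfl] at h
  change ‖(weightActD p ℚ_[p] k ha hc b d μ).1 n s‖ ≤ 1
  rw [h]
  have := ((ProfiniteTower.padicInt p).toBounded₁ hμ).norm_integral_le
    (uniformContinuous_cellInd_moebius_mul_autPow k ha hc b d n s) zero_le_one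
    (norm_cellInd_moebius_mul_autPow_le k ha hc b d n s)
  rwa [ProfiniteTower.toBounded₁_bound, one_mul] at this

/-- **Every `K_N` is stable under the weight-`k` action of `Σ₀(p)`** (the finite approximation modules
`𝔻⁰/K_N` inherit the action). [cite: PollackStevens2011, §3] -/
theorem weightActD_mem_congrSub (k : ℕ) {a c : ℤ_[p]} (ha : ‖a‖ = 1) (hc : ‖c‖ < 1) (b d : ℤ_[p]) (N : ℕ)
    (μ : (ProfiniteTower.padicInt p).distributions ℚ_[p])
    (hμ : μ.1 ∈ (ProfiniteTower.padicInt p).congrSub p N) :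
    (weightActD p ℚ_[p] k ha hc b d μ).1 ∈ (ProfiniteTower.padicInt p).congrSub p N := by
  refine ⟨weightActD_mem_distributionsInt k ha hc b d μ hμ.1, fun s => ?_⟩
  rw [weightActD_apply]
  refine norm_integralFn_le_of_mem_congrSub hμ (uniformContinuous_cellInd_moebius_mul_autPow k ha hc b d N s)
    (norm_cellInd_moebius_mul_autPow_le k ha hc b d N s) fun x y hxy => ?_
  -- on a residue class the indicator factor is constant and the power varies by `≤ ‖x − y‖ ≤ p^{-N}`
  have hind : cellInd (𝕜 := ℚ_[p]) N s (moebius ha hc b d x) = cellInd N s (moebius ha hc b d y) := by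
    rw [cellInd_apply, cellInd_apply, toZModPow_moebius_eq ha hc b d N hxy]
  rw [hind, ← mul_sub, norm_mul]
  calc ‖cellInd (𝕜 := ℚ_[p]) N s (moebius ha hc b d y)‖ *
        ‖BoundedDistribution.autPow (𝕜 := ℚ_[p]) k a c x - BoundedDistribution.autPow k a c y‖
      ≤ 1 * ‖x - y‖ := mul_le_mul (norm_cellInd_le _ _ _) (norm_autPow_sub_autPow_le k a c x y)
          (norm_nonneg _) zero_le_one
    _ ≤ (p : ℝ) ^ (-(N : ℤ)) := by
        -- same residue modulo `p^N` means distance `≤ p^{-N}` (cf. `PadicBox.norm_sub_le_of_toZModPow_eq`)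
        rw [one_mul, PadicInt.norm_le_pow_iff_mem_span_pow, ← PadicInt.ker_toZModPow, RingHom.mem_ker, map_sub,
          hxy, sub_self]

end WeightK

end Literature.NumberTheory.EllipticCurves

end
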